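import Summits.Ventures.GridStability.Bench.KUNDUR2ACSGDeg2AOwnVNu4ibk3m1PpRoa
import Summits.Ventures.GridStability.Lyapunov.AngleRecovery
import Summits.Ventures.GridStability.Models.RecastLiteralsKundur2A
import Mathlib.Analysis.SpecialFunctions.Trigonometric.Deriv
import Mathlib.Tactic.IntervalCases
import HarnessLib

/-!
# G2.a «K2A-alg-deg2»-roa (model half) — no pole slip and return to synchronism FOR model-1's
# two-area four-machine model `Kundur2A.csgPre.toModelRel (1/10) a′` (uniform damping ratio `1/10`)

Venture GRIDFUSION, `plan/PARTITION.md` A5 (bridge) / A6 (arc rule) / A24 third addendum (1), lead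
RULING R-G2A-OBJECT 2026-08-27T05:34:39Z (#22) and lead g3 FINAL HANDOFF («-roa later (lyap-1)»);
seat gridfusion-lyap-1 (g4). Sibling of `KUNDUR2ACSGDeg2AOwnVNu4ibk3m1PpRoa.lean` (recast half,
p507108), which it imports; uses model-1's `Models/PolynomialiseRel.lean` (`RecastData.embedRel`,
`toModelRel`, `embedRel_of_lt / _mid / _high`), `Models/Kundur2A.lean` (`Kundur2A.csgPre : RecastData 3`,
the hypothesis-free chain rule `Kundur2A.hasDerivWithinAt_embedRel`, p466090 / p473726),
`Models/RecastLiteralsKundur2A.lean` (`csgPre_relField_lambda_eq`: the field of record as a kernel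
literal, p482037) and `Lyapunov/AngleRecovery.lean` (p460639: window persistence and angle return).

FAITHFULNESS IN THE KERNEL (`deg2_A_ownV_nu4ibk3m1_pp_relField_eval_<k>`): component `k` of the TREE OBJECT
`Kundur2A.csgPre.relField (1/10)` and the certificate's literal `f_<var>_poly` have the same normal
form (`SOS.Poly.norm`, one `decide +kernel` each after `csgPre_relField_lambda_eq`), so the Bench field
IS the push-forward of the two-area swing dynamics along model-1's exact relative embedding
`embedRel` — the Lean-level form of sos-1's / ref-1's «f verbatim» check. The valuation bridge
`deg2_A_ownV_nu4ibk3m1_pp_vars_Z` identifies the Bench valuation `vars [z₀, …, z₈]` with `embedRel θ⋆ x`.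

THREE COLUMNS. CERTIFIED: the six Bench identities (consumed only through `deg2_A_ownV_nu4ibk3m1_pp_roa`). MODELLED:
every theorem here is about model-1's classical model `Kundur2A.csgPre.toModelRel (1/10) a′`
(`ClassicalSwing (3+1)`: Chow–Sanchez-Gasca two-area four-machine data, Kron-reduced with
constant-impedance loads, transfer conductances kept, K rounded h12, scaled time with unit inertias,
ASSUMED UNIFORM DAMPING RATIO `λ = 1/10` — census label «synthetic uniform damping on the printed
two-area network», never a sentence about the printed `D = 0` system — and an ARBITRARY common
acceleration `a′ ∈ ℝ`, which cancels in every relative quantity; equilibrium relative angles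
`θ⋆ = Kundur2A.csgPre.angleOf` (exact circle points, `Kundur2A.csgPre_eqData`); MODEL-VALIDITY token =
model-2's KUNDUR2A-CSG block + MV-λ(1/10)). VALIDATED: nothing. No sentence of this file says a grid
is stable; «return to synchronism» below is a property OF THE MODEL for the stated initial data.

STATEMENT (`deg2_A_ownV_nu4ibk3m1_pp_model_roa`): for every `a′`, every `0 < γ ≤ 3/53` and every solution `c` of the model on
`[0, ∞)` whose relative recast initial state `Z (c 0)` satisfies `V ≤ γ` and whose initial relative
angle deviations satisfy `|u_i(0)| < π` (`i = 1, 2, 3`): `V(Z (c t)) ≤ γ` for all `t ≥ 0`; no relative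
angle deviation ever reaches `±π` (no pole slip); every `u_i(t) → 0`; every relative speed
`ω_i(t) − ω_0(t) → 0`. Existence of global solutions is not restated (Literature.Analysis.ODE).
-/

namespace Summit.Ventures.GridStability.Bench.KUNDUR2ACSG

open Set Filter Metric Topology Real
open Summit.Ventures.GridStability.Lyapunov Summit.Ventures.GridStability.Models
open Literature.Computation.Certificates Literature.Computation.Certificates.SOS

noncomputable section

/-! ### The relative recast state of the two-area model as a point of `Fin 9 → ℝ` -/

/-- The relative recast coordinates of a state `x = (δ, ω)` of the four-machine model: model-1's
`RecastData.embedRel θ⋆ x` restricted to the indices `< 9`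
(`= (sin u₁, 1 − cos u₁, sin u₂, 1 − cos u₂, sin u₃, 1 − cos u₃, ω₁ − ω₀, ω₂ − ω₀, ω₃ − ω₀)`,
`deg2_A_ownV_nu4ibk3m1_pp_Z_eq_<k>`). [folklore] -/
def deg2_A_ownV_nu4ibk3m1_pp_Z (x : ClassicalSwing.State 4) : Fin 9 → ℝ :=
  fun k ↦ RecastData.embedRel Kundur2A.csgPre.angleOf x k

/-- **Valuation bridge**: the Bench valuation of `Z x` IS model-1's relative embedding (indices `≥ 9`
are `0` on both sides). [folklore] -/
theorem deg2_A_ownV_nu4ibk3m1_pp_vars_Z (x : ClassicalSwing.State 4) :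
    vars [deg2_A_ownV_nu4ibk3m1_pp_Z x 0, deg2_A_ownV_nu4ibk3m1_pp_Z x 1, deg2_A_ownV_nu4ibk3m1_pp_Z x 2, deg2_A_ownV_nu4ibk3m1_pp_Z x 3, deg2_A_ownV_nu4ibk3m1_pp_Z x 4, deg2_A_ownV_nu4ibk3m1_pp_Z x 5, deg2_A_ownV_nu4ibk3m1_pp_Z x 6, deg2_A_ownV_nu4ibk3m1_pp_Z x 7, deg2_A_ownV_nu4ibk3m1_pp_Z x 8] =
      RecastData.embedRel Kundur2A.csgPre.angleOf x := by
  funext k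
  rcases Nat.lt_or_ge k 9 with hk | hk
  · interval_cases k <;> rfl
  · rw [RecastData.embedRel_high (n := 3) Kundur2A.csgPre.angleOf x (k := k) (by omega)]
    exact List.getD_eq_default _ _ (by simp; omega)

/-- Closed form of coordinate `0` of `deg2_A_ownV_nu4ibk3m1_pp_Z`. [folklore] -/
theorem deg2_A_ownV_nu4ibk3m1_pp_Z_eq_0 (x : ClassicalSwing.State 4) : deg2_A_ownV_nu4ibk3m1_pp_Z x 0 = sin (RecastData.u Kundur2A.csgPre.angleOf x 1) := by
  show RecastData.embedRel Kundur2A.csgPre.angleOf x 0 = _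
  rw [RecastData.embedRel_of_lt (n := 3) Kundur2A.csgPre.angleOf x (by norm_num)]
  simpa using RecastData.embed_σ (n := 3) Kundur2A.csgPre.angleOf x (0 : Fin 3)

/-- Closed form of coordinate `1` of `deg2_A_ownV_nu4ibk3m1_pp_Z`. [folklore] -/
theorem deg2_A_ownV_nu4ibk3m1_pp_Z_eq_1 (x : ClassicalSwing.State 4) : deg2_A_ownV_nu4ibk3m1_pp_Z x 1 = 1 - cos (RecastData.u Kundur2A.csgPre.angleOf x 1) := by
  show RecastData.embedRel Kundur2A.csgPre.angleOf x 1 = _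
  rw [RecastData.embedRel_of_lt (n := 3) Kundur2A.csgPre.angleOf x (by norm_num)]
  simpa using RecastData.embed_κ (n := 3) Kundur2A.csgPre.angleOf x (0 : Fin 3)

/-- Closed form of coordinate `2` of `deg2_A_ownV_nu4ibk3m1_pp_Z`. [folklore] -/
theorem deg2_A_ownV_nu4ibk3m1_pp_Z_eq_2 (x : ClassicalSwing.State 4) : deg2_A_ownV_nu4ibk3m1_pp_Z x 2 = sin (RecastData.u Kundur2A.csgPre.angleOf x 2) := by
  show RecastData.embedRel Kundur2A.csgPre.angleOf x 2 = _
  rw [RecastData.embedRel_of_lt (n := 3) Kundur2A.csgPre.angleOf x (by norm_num)]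
  simpa using RecastData.embed_σ (n := 3) Kundur2A.csgPre.angleOf x (1 : Fin 3)

/-- Closed form of coordinate `3` of `deg2_A_ownV_nu4ibk3m1_pp_Z`. [folklore] -/
theorem deg2_A_ownV_nu4ibk3m1_pp_Z_eq_3 (x : ClassicalSwing.State 4) : deg2_A_ownV_nu4ibk3m1_pp_Z x 3 = 1 - cos (RecastData.u Kundur2A.csgPre.angleOf x 2) := by
  show RecastData.embedRel Kundur2A.csgPre.angleOf x 3 = _
  rw [RecastData.embedRel_of_lt (n := 3) Kundur2A.csgPre.angleOf x (by norm_num)]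
  simpa using RecastData.embed_κ (n := 3) Kundur2A.csgPre.angleOf x (1 : Fin 3)

/-- Closed form of coordinate `4` of `deg2_A_ownV_nu4ibk3m1_pp_Z`. [folklore] -/
theorem deg2_A_ownV_nu4ibk3m1_pp_Z_eq_4 (x : ClassicalSwing.State 4) : deg2_A_ownV_nu4ibk3m1_pp_Z x 4 = sin (RecastData.u Kundur2A.csgPre.angleOf x 3) := by
  show RecastData.embedRel Kundur2A.csgPre.angleOf x 4 = _
  rw [RecastData.embedRel_of_lt (n := 3) Kundur2A.csgPre.angleOf x (by norm_num)]
  simpa using RecastData.embed_σ (n := 3) Kundur2A.csgPre.angleOf x (2 : Fin 3)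

/-- Closed form of coordinate `5` of `deg2_A_ownV_nu4ibk3m1_pp_Z`. [folklore] -/
theorem deg2_A_ownV_nu4ibk3m1_pp_Z_eq_5 (x : ClassicalSwing.State 4) : deg2_A_ownV_nu4ibk3m1_pp_Z x 5 = 1 - cos (RecastData.u Kundur2A.csgPre.angleOf x 3) := by
  show RecastData.embedRel Kundur2A.csgPre.angleOf x 5 = _
  rw [RecastData.embedRel_of_lt (n := 3) Kundur2A.csgPre.angleOf x (by norm_num)]
  simpa using RecastData.embed_κ (n := 3) Kundur2A.csgPre.angleOf x (2 : Fin 3)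

/-- Closed form of coordinate `6` of `deg2_A_ownV_nu4ibk3m1_pp_Z`. [folklore] -/
theorem deg2_A_ownV_nu4ibk3m1_pp_Z_eq_6 (x : ClassicalSwing.State 4) : deg2_A_ownV_nu4ibk3m1_pp_Z x 6 = x.2 1 - x.2 0 := by
  show RecastData.embedRel Kundur2A.csgPre.angleOf x 6 = _
  simpa using RecastData.embedRel_mid (n := 3) Kundur2A.csgPre.angleOf x (k := 6) (by norm_num) (by norm_num)

/-- Closed form of coordinate `7` of `deg2_A_ownV_nu4ibk3m1_pp_Z`. [folklore] -/
theorem deg2_A_ownV_nu4ibk3m1_pp_Z_eq_7 (x : ClassicalSwing.State 4) : deg2_A_ownV_nu4ibk3m1_pp_Z x 7 = x.2 2 - x.2 0 := by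
  show RecastData.embedRel Kundur2A.csgPre.angleOf x 7 = _
  simpa using RecastData.embedRel_mid (n := 3) Kundur2A.csgPre.angleOf x (k := 7) (by norm_num) (by norm_num)

/-- Closed form of coordinate `8` of `deg2_A_ownV_nu4ibk3m1_pp_Z`. [folklore] -/
theorem deg2_A_ownV_nu4ibk3m1_pp_Z_eq_8 (x : ClassicalSwing.State 4) : deg2_A_ownV_nu4ibk3m1_pp_Z x 8 = x.2 3 - x.2 0 := by
  show RecastData.embedRel Kundur2A.csgPre.angleOf x 8 = _
  simpa using RecastData.embedRel_mid (n := 3) Kundur2A.csgPre.angleOf x (k := 8) (by norm_num) (by norm_num)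

/-! ### Kernel faithfulness: the tree field `Kundur2A.csgPre.relField (1/10)` IS the Bench field -/

/-- Component `0` of `Kundur2A.csgPre.relField (1/10)` evaluates on the relative embedding to the
Bench decl `deg2_A_ownV_nu4ibk3m1_pp_f_sigma_2` at `Z x` (same `Poly.norm`, one `decide +kernel`). [folklore] -/
theorem deg2_A_ownV_nu4ibk3m1_pp_relField_eval_0 (x : ClassicalSwing.State 4) :
    ((Kundur2A.csgPre.relField (1 / 10)).getD 0 []).eval (RecastData.embedRel Kundur2A.csgPre.angleOf x) =
      deg2_A_ownV_nu4ibk3m1_pp_f_sigma_2 (deg2_A_ownV_nu4ibk3m1_pp_Z x 0) (deg2_A_ownV_nu4ibk3m1_pp_Z x 1) (deg2_A_ownV_nu4ibk3m1_pp_Z x 2) (deg2_A_ownV_nu4ibk3m1_pp_Z x 3) (deg2_A_ownV_nu4ibk3m1_pp_Z x 4) (deg2_A_ownV_nu4ibk3m1_pp_Z x 5) (deg2_A_ownV_nu4ibk3m1_pp_Z x 6) (deg2_A_ownV_nu4ibk3m1_pp_Z x 7) (deg2_A_ownV_nu4ibk3m1_pp_Z x 8) := by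
  have hn : Poly.norm ((Kundur2A.csgPre.relField (1 / 10)).getD 0 []) = Poly.norm deg2_A_ownV_nu4ibk3m1_pp_f_sigma_2_poly := by
    rw [Kundur2A.csgPre_relField_lambda_eq]; decide +kernel
  rw [← Poly.eval_norm, hn, Poly.eval_norm, deg2_A_ownV_nu4ibk3m1_pp_f_sigma_2, deg2_A_ownV_nu4ibk3m1_pp_vars_Z]

/-- Component `1` of `Kundur2A.csgPre.relField (1/10)` evaluates on the relative embedding to the
Bench decl `deg2_A_ownV_nu4ibk3m1_pp_f_kappa_2` at `Z x` (same `Poly.norm`, one `decide +kernel`). [folklore] -/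
theorem deg2_A_ownV_nu4ibk3m1_pp_relField_eval_1 (x : ClassicalSwing.State 4) :
    ((Kundur2A.csgPre.relField (1 / 10)).getD 1 []).eval (RecastData.embedRel Kundur2A.csgPre.angleOf x) =
      deg2_A_ownV_nu4ibk3m1_pp_f_kappa_2 (deg2_A_ownV_nu4ibk3m1_pp_Z x 0) (deg2_A_ownV_nu4ibk3m1_pp_Z x 1) (deg2_A_ownV_nu4ibk3m1_pp_Z x 2) (deg2_A_ownV_nu4ibk3m1_pp_Z x 3) (deg2_A_ownV_nu4ibk3m1_pp_Z x 4) (deg2_A_ownV_nu4ibk3m1_pp_Z x 5) (deg2_A_ownV_nu4ibk3m1_pp_Z x 6) (deg2_A_ownV_nu4ibk3m1_pp_Z x 7) (deg2_A_ownV_nu4ibk3m1_pp_Z x 8) := by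
  have hn : Poly.norm ((Kundur2A.csgPre.relField (1 / 10)).getD 1 []) = Poly.norm deg2_A_ownV_nu4ibk3m1_pp_f_kappa_2_poly := by
    rw [Kundur2A.csgPre_relField_lambda_eq]; decide +kernel
  rw [← Poly.eval_norm, hn, Poly.eval_norm, deg2_A_ownV_nu4ibk3m1_pp_f_kappa_2, deg2_A_ownV_nu4ibk3m1_pp_vars_Z]

/-- Component `2` of `Kundur2A.csgPre.relField (1/10)` evaluates on the relative embedding to the
Bench decl `deg2_A_ownV_nu4ibk3m1_pp_f_sigma_11` at `Z x` (same `Poly.norm`, one `decide +kernel`). [folklore] -/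
theorem deg2_A_ownV_nu4ibk3m1_pp_relField_eval_2 (x : ClassicalSwing.State 4) :
    ((Kundur2A.csgPre.relField (1 / 10)).getD 2 []).eval (RecastData.embedRel Kundur2A.csgPre.angleOf x) =
      deg2_A_ownV_nu4ibk3m1_pp_f_sigma_11 (deg2_A_ownV_nu4ibk3m1_pp_Z x 0) (deg2_A_ownV_nu4ibk3m1_pp_Z x 1) (deg2_A_ownV_nu4ibk3m1_pp_Z x 2) (deg2_A_ownV_nu4ibk3m1_pp_Z x 3) (deg2_A_ownV_nu4ibk3m1_pp_Z x 4) (deg2_A_ownV_nu4ibk3m1_pp_Z x 5) (deg2_A_ownV_nu4ibk3m1_pp_Z x 6) (deg2_A_ownV_nu4ibk3m1_pp_Z x 7) (deg2_A_ownV_nu4ibk3m1_pp_Z x 8) := by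
  have hn : Poly.norm ((Kundur2A.csgPre.relField (1 / 10)).getD 2 []) = Poly.norm deg2_A_ownV_nu4ibk3m1_pp_f_sigma_11_poly := by
    rw [Kundur2A.csgPre_relField_lambda_eq]; decide +kernel
  rw [← Poly.eval_norm, hn, Poly.eval_norm, deg2_A_ownV_nu4ibk3m1_pp_f_sigma_11, deg2_A_ownV_nu4ibk3m1_pp_vars_Z]

/-- Component `3` of `Kundur2A.csgPre.relField (1/10)` evaluates on the relative embedding to the
Bench decl `deg2_A_ownV_nu4ibk3m1_pp_f_kappa_11` at `Z x` (same `Poly.norm`, one `decide +kernel`). [folklore] -/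
theorem deg2_A_ownV_nu4ibk3m1_pp_relField_eval_3 (x : ClassicalSwing.State 4) :
    ((Kundur2A.csgPre.relField (1 / 10)).getD 3 []).eval (RecastData.embedRel Kundur2A.csgPre.angleOf x) =
      deg2_A_ownV_nu4ibk3m1_pp_f_kappa_11 (deg2_A_ownV_nu4ibk3m1_pp_Z x 0) (deg2_A_ownV_nu4ibk3m1_pp_Z x 1) (deg2_A_ownV_nu4ibk3m1_pp_Z x 2) (deg2_A_ownV_nu4ibk3m1_pp_Z x 3) (deg2_A_ownV_nu4ibk3m1_pp_Z x 4) (deg2_A_ownV_nu4ibk3m1_pp_Z x 5) (deg2_A_ownV_nu4ibk3m1_pp_Z x 6) (deg2_A_ownV_nu4ibk3m1_pp_Z x 7) (deg2_A_ownV_nu4ibk3m1_pp_Z x 8) := by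
  have hn : Poly.norm ((Kundur2A.csgPre.relField (1 / 10)).getD 3 []) = Poly.norm deg2_A_ownV_nu4ibk3m1_pp_f_kappa_11_poly := by
    rw [Kundur2A.csgPre_relField_lambda_eq]; decide +kernel
  rw [← Poly.eval_norm, hn, Poly.eval_norm, deg2_A_ownV_nu4ibk3m1_pp_f_kappa_11, deg2_A_ownV_nu4ibk3m1_pp_vars_Z]

/-- Component `4` of `Kundur2A.csgPre.relField (1/10)` evaluates on the relative embedding to the
Bench decl `deg2_A_ownV_nu4ibk3m1_pp_f_sigma_12` at `Z x` (same `Poly.norm`, one `decide +kernel`). [folklore] -/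
theorem deg2_A_ownV_nu4ibk3m1_pp_relField_eval_4 (x : ClassicalSwing.State 4) :
    ((Kundur2A.csgPre.relField (1 / 10)).getD 4 []).eval (RecastData.embedRel Kundur2A.csgPre.angleOf x) =
      deg2_A_ownV_nu4ibk3m1_pp_f_sigma_12 (deg2_A_ownV_nu4ibk3m1_pp_Z x 0) (deg2_A_ownV_nu4ibk3m1_pp_Z x 1) (deg2_A_ownV_nu4ibk3m1_pp_Z x 2) (deg2_A_ownV_nu4ibk3m1_pp_Z x 3) (deg2_A_ownV_nu4ibk3m1_pp_Z x 4) (deg2_A_ownV_nu4ibk3m1_pp_Z x 5) (deg2_A_ownV_nu4ibk3m1_pp_Z x 6) (deg2_A_ownV_nu4ibk3m1_pp_Z x 7) (deg2_A_ownV_nu4ibk3m1_pp_Z x 8) := by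
  have hn : Poly.norm ((Kundur2A.csgPre.relField (1 / 10)).getD 4 []) = Poly.norm deg2_A_ownV_nu4ibk3m1_pp_f_sigma_12_poly := by
    rw [Kundur2A.csgPre_relField_lambda_eq]; decide +kernel
  rw [← Poly.eval_norm, hn, Poly.eval_norm, deg2_A_ownV_nu4ibk3m1_pp_f_sigma_12, deg2_A_ownV_nu4ibk3m1_pp_vars_Z]

/-- Component `5` of `Kundur2A.csgPre.relField (1/10)` evaluates on the relative embedding to the
Bench decl `deg2_A_ownV_nu4ibk3m1_pp_f_kappa_12` at `Z x` (same `Poly.norm`, one `decide +kernel`). [folklore] -/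
theorem deg2_A_ownV_nu4ibk3m1_pp_relField_eval_5 (x : ClassicalSwing.State 4) :
    ((Kundur2A.csgPre.relField (1 / 10)).getD 5 []).eval (RecastData.embedRel Kundur2A.csgPre.angleOf x) =
      deg2_A_ownV_nu4ibk3m1_pp_f_kappa_12 (deg2_A_ownV_nu4ibk3m1_pp_Z x 0) (deg2_A_ownV_nu4ibk3m1_pp_Z x 1) (deg2_A_ownV_nu4ibk3m1_pp_Z x 2) (deg2_A_ownV_nu4ibk3m1_pp_Z x 3) (deg2_A_ownV_nu4ibk3m1_pp_Z x 4) (deg2_A_ownV_nu4ibk3m1_pp_Z x 5) (deg2_A_ownV_nu4ibk3m1_pp_Z x 6) (deg2_A_ownV_nu4ibk3m1_pp_Z x 7) (deg2_A_ownV_nu4ibk3m1_pp_Z x 8) := by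
  have hn : Poly.norm ((Kundur2A.csgPre.relField (1 / 10)).getD 5 []) = Poly.norm deg2_A_ownV_nu4ibk3m1_pp_f_kappa_12_poly := by
    rw [Kundur2A.csgPre_relField_lambda_eq]; decide +kernel
  rw [← Poly.eval_norm, hn, Poly.eval_norm, deg2_A_ownV_nu4ibk3m1_pp_f_kappa_12, deg2_A_ownV_nu4ibk3m1_pp_vars_Z]

/-- Component `6` of `Kundur2A.csgPre.relField (1/10)` evaluates on the relative embedding to the
Bench decl `deg2_A_ownV_nu4ibk3m1_pp_f_nu_2` at `Z x` (same `Poly.norm`, one `decide +kernel`). [folklore] -/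
theorem deg2_A_ownV_nu4ibk3m1_pp_relField_eval_6 (x : ClassicalSwing.State 4) :
    ((Kundur2A.csgPre.relField (1 / 10)).getD 6 []).eval (RecastData.embedRel Kundur2A.csgPre.angleOf x) =
      deg2_A_ownV_nu4ibk3m1_pp_f_nu_2 (deg2_A_ownV_nu4ibk3m1_pp_Z x 0) (deg2_A_ownV_nu4ibk3m1_pp_Z x 1) (deg2_A_ownV_nu4ibk3m1_pp_Z x 2) (deg2_A_ownV_nu4ibk3m1_pp_Z x 3) (deg2_A_ownV_nu4ibk3m1_pp_Z x 4) (deg2_A_ownV_nu4ibk3m1_pp_Z x 5) (deg2_A_ownV_nu4ibk3m1_pp_Z x 6) (deg2_A_ownV_nu4ibk3m1_pp_Z x 7) (deg2_A_ownV_nu4ibk3m1_pp_Z x 8) := by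
  have hn : Poly.norm ((Kundur2A.csgPre.relField (1 / 10)).getD 6 []) = Poly.norm deg2_A_ownV_nu4ibk3m1_pp_f_nu_2_poly := by
    rw [Kundur2A.csgPre_relField_lambda_eq]; decide +kernel
  rw [← Poly.eval_norm, hn, Poly.eval_norm, deg2_A_ownV_nu4ibk3m1_pp_f_nu_2, deg2_A_ownV_nu4ibk3m1_pp_vars_Z]

/-- Component `7` of `Kundur2A.csgPre.relField (1/10)` evaluates on the relative embedding to the
Bench decl `deg2_A_ownV_nu4ibk3m1_pp_f_nu_11` at `Z x` (same `Poly.norm`, one `decide +kernel`). [folklore] -/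
theorem deg2_A_ownV_nu4ibk3m1_pp_relField_eval_7 (x : ClassicalSwing.State 4) :
    ((Kundur2A.csgPre.relField (1 / 10)).getD 7 []).eval (RecastData.embedRel Kundur2A.csgPre.angleOf x) =
      deg2_A_ownV_nu4ibk3m1_pp_f_nu_11 (deg2_A_ownV_nu4ibk3m1_pp_Z x 0) (deg2_A_ownV_nu4ibk3m1_pp_Z x 1) (deg2_A_ownV_nu4ibk3m1_pp_Z x 2) (deg2_A_ownV_nu4ibk3m1_pp_Z x 3) (deg2_A_ownV_nu4ibk3m1_pp_Z x 4) (deg2_A_ownV_nu4ibk3m1_pp_Z x 5) (deg2_A_ownV_nu4ibk3m1_pp_Z x 6) (deg2_A_ownV_nu4ibk3m1_pp_Z x 7) (deg2_A_ownV_nu4ibk3m1_pp_Z x 8) := by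
  have hn : Poly.norm ((Kundur2A.csgPre.relField (1 / 10)).getD 7 []) = Poly.norm deg2_A_ownV_nu4ibk3m1_pp_f_nu_11_poly := by
    rw [Kundur2A.csgPre_relField_lambda_eq]; decide +kernel
  rw [← Poly.eval_norm, hn, Poly.eval_norm, deg2_A_ownV_nu4ibk3m1_pp_f_nu_11, deg2_A_ownV_nu4ibk3m1_pp_vars_Z]

/-- Component `8` of `Kundur2A.csgPre.relField (1/10)` evaluates on the relative embedding to the
Bench decl `deg2_A_ownV_nu4ibk3m1_pp_f_nu_12` at `Z x` (same `Poly.norm`, one `decide +kernel`). [folklore] -/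
theorem deg2_A_ownV_nu4ibk3m1_pp_relField_eval_8 (x : ClassicalSwing.State 4) :
    ((Kundur2A.csgPre.relField (1 / 10)).getD 8 []).eval (RecastData.embedRel Kundur2A.csgPre.angleOf x) =
      deg2_A_ownV_nu4ibk3m1_pp_f_nu_12 (deg2_A_ownV_nu4ibk3m1_pp_Z x 0) (deg2_A_ownV_nu4ibk3m1_pp_Z x 1) (deg2_A_ownV_nu4ibk3m1_pp_Z x 2) (deg2_A_ownV_nu4ibk3m1_pp_Z x 3) (deg2_A_ownV_nu4ibk3m1_pp_Z x 4) (deg2_A_ownV_nu4ibk3m1_pp_Z x 5) (deg2_A_ownV_nu4ibk3m1_pp_Z x 6) (deg2_A_ownV_nu4ibk3m1_pp_Z x 7) (deg2_A_ownV_nu4ibk3m1_pp_Z x 8) := by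
  have hn : Poly.norm ((Kundur2A.csgPre.relField (1 / 10)).getD 8 []) = Poly.norm deg2_A_ownV_nu4ibk3m1_pp_f_nu_12_poly := by
    rw [Kundur2A.csgPre_relField_lambda_eq]; decide +kernel
  rw [← Poly.eval_norm, hn, Poly.eval_norm, deg2_A_ownV_nu4ibk3m1_pp_f_nu_12, deg2_A_ownV_nu4ibk3m1_pp_vars_Z]

/-! ### Exact embedding along solutions of the model -/

/-- **Exact embedding** (model-1's `Kundur2A.hasDerivWithinAt_embedRel` in the Bench vocabulary): along
every solution `c` of `Kundur2A.csgPre.toModelRel (1/10) a′` on `s`, the relative recast curve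
`t ↦ Z (c t)` solves `ż = F(z)` with the Bench field. [folklore] -/
theorem deg2_A_ownV_nu4ibk3m1_pp_hasDerivWithinAt_Z (a : ℝ) {c : ℝ → ClassicalSwing.State 4} {s : Set ℝ}
    (hc : (Kundur2A.csgPre.toModelRel (1 / 10) a).IsSolutionOn c s) {t : ℝ} (ht : t ∈ s) :
    HasDerivWithinAt (fun τ ↦ deg2_A_ownV_nu4ibk3m1_pp_Z (c τ)) (deg2_A_ownV_nu4ibk3m1_pp_F (deg2_A_ownV_nu4ibk3m1_pp_Z (c t))) s t := by
  refine hasDerivWithinAt_pi.2 fun k ↦ ?_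
  fin_cases k
  · have h := Kundur2A.hasDerivWithinAt_embedRel (1 / 10) a hc ht 0
    rw [deg2_A_ownV_nu4ibk3m1_pp_relField_eval_0] at h
    exact h
  · have h := Kundur2A.hasDerivWithinAt_embedRel (1 / 10) a hc ht 1
    rw [deg2_A_ownV_nu4ibk3m1_pp_relField_eval_1] at h
    exact h
  · have h := Kundur2A.hasDerivWithinAt_embedRel (1 / 10) a hc ht 2
    rw [deg2_A_ownV_nu4ibk3m1_pp_relField_eval_2] at h
    exact h
  · have h := Kundur2A.hasDerivWithinAt_embedRel (1 / 10) a hc ht 3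
    rw [deg2_A_ownV_nu4ibk3m1_pp_relField_eval_3] at h
    exact h
  · have h := Kundur2A.hasDerivWithinAt_embedRel (1 / 10) a hc ht 4
    rw [deg2_A_ownV_nu4ibk3m1_pp_relField_eval_4] at h
    exact h
  · have h := Kundur2A.hasDerivWithinAt_embedRel (1 / 10) a hc ht 5
    rw [deg2_A_ownV_nu4ibk3m1_pp_relField_eval_5] at h
    exact h
  · have h := Kundur2A.hasDerivWithinAt_embedRel (1 / 10) a hc ht 6
    rw [deg2_A_ownV_nu4ibk3m1_pp_relField_eval_6] at h
    exact h
  · have h := Kundur2A.hasDerivWithinAt_embedRel (1 / 10) a hc ht 7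
    rw [deg2_A_ownV_nu4ibk3m1_pp_relField_eval_7] at h
    exact h
  · have h := Kundur2A.hasDerivWithinAt_embedRel (1 / 10) a hc ht 8
    rw [deg2_A_ownV_nu4ibk3m1_pp_relField_eval_8] at h
    exact h

/-- The relative recast state of any model state lies on the constraint set `M`
(`sin² u + (1 − cos u)² − 2(1 − cos u) = 0`). [folklore] -/
theorem deg2_A_ownV_nu4ibk3m1_pp_Z_mem_M (x : ClassicalSwing.State 4) : deg2_A_ownV_nu4ibk3m1_pp_Z x ∈ deg2_A_ownV_nu4ibk3m1_pp_M := by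
  show deg2_A_ownV_nu4ibk3m1_pp_h1 (deg2_A_ownV_nu4ibk3m1_pp_Z x 0) (deg2_A_ownV_nu4ibk3m1_pp_Z x 1) (deg2_A_ownV_nu4ibk3m1_pp_Z x 2) (deg2_A_ownV_nu4ibk3m1_pp_Z x 3) (deg2_A_ownV_nu4ibk3m1_pp_Z x 4) (deg2_A_ownV_nu4ibk3m1_pp_Z x 5) (deg2_A_ownV_nu4ibk3m1_pp_Z x 6) (deg2_A_ownV_nu4ibk3m1_pp_Z x 7) (deg2_A_ownV_nu4ibk3m1_pp_Z x 8) = 0 ∧ deg2_A_ownV_nu4ibk3m1_pp_h2 (deg2_A_ownV_nu4ibk3m1_pp_Z x 0) (deg2_A_ownV_nu4ibk3m1_pp_Z x 1) (deg2_A_ownV_nu4ibk3m1_pp_Z x 2) (deg2_A_ownV_nu4ibk3m1_pp_Z x 3) (deg2_A_ownV_nu4ibk3m1_pp_Z x 4) (deg2_A_ownV_nu4ibk3m1_pp_Z x 5) (deg2_A_ownV_nu4ibk3m1_pp_Z x 6) (deg2_A_ownV_nu4ibk3m1_pp_Z x 7) (deg2_A_ownV_nu4ibk3m1_pp_Z x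 8) = 0 ∧ deg2_A_ownV_nu4ibk3m1_pp_h3 (deg2_A_ownV_nu4ibk3m1_pp_Z x 0) (deg2_A_ownV_nu4ibk3m1_pp_Z x 1) (deg2_A_ownV_nu4ibk3m1_pp_Z x 2) (deg2_A_ownV_nu4ibk3m1_pp_Z x 3) (deg2_A_ownV_nu4ibk3m1_pp_Z x 4) (deg2_A_ownV_nu4ibk3m1_pp_Z x 5) (deg2_A_ownV_nu4ibk3m1_pp_Z x 6) (deg2_A_ownV_nu4ibk3m1_pp_Z x 7) (deg2_A_ownV_nu4ibk3m1_pp_Z x 8) = 0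
  refine ⟨?_, ?_, ?_⟩
  · rw [deg2_A_ownV_nu4ibk3m1_pp_h1_eq, deg2_A_ownV_nu4ibk3m1_pp_Z_eq_0, deg2_A_ownV_nu4ibk3m1_pp_Z_eq_1]
    nlinarith [sin_sq_add_cos_sq (RecastData.u Kundur2A.csgPre.angleOf x 1)]
  · rw [deg2_A_ownV_nu4ibk3m1_pp_h2_eq, deg2_A_ownV_nu4ibk3m1_pp_Z_eq_2, deg2_A_ownV_nu4ibk3m1_pp_Z_eq_3]
    nlinarith [sin_sq_add_cos_sq (RecastData.u Kundur2A.csgPre.angleOf x 2)]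
  · rw [deg2_A_ownV_nu4ibk3m1_pp_h3_eq, deg2_A_ownV_nu4ibk3m1_pp_Z_eq_4, deg2_A_ownV_nu4ibk3m1_pp_Z_eq_5]
    nlinarith [sin_sq_add_cos_sq (RecastData.u Kundur2A.csgPre.angleOf x 3)]

/-! ### The ROA sentence in machine coordinates -/

/-- **G2.a-roa in original coordinates (two-area four-machine model, uniform damping ratio `1/10`,
any common acceleration `a′`), with angle recovery (A6).** See the module docstring for the three
columns. For every `0 < γ ≤ 3/53` and every solution `c` on `[0, ∞)` with `V(Z (c 0)) ≤ γ` and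
`|u_i(0)| < π`: the certified piece is never left, no relative rotor angle deviation reaches `±π`,
`u_i(t) → 0` and `ω_i(t) − ω_0(t) → 0` (`i = 1, 2, 3`). [folklore] -/
theorem deg2_A_ownV_nu4ibk3m1_pp_model_roa (a : ℝ) {γ : ℝ} (hγ0 : 0 < γ) (hγ : γ ≤ deg2_A_ownV_nu4ibk3m1_pp_level)
    {c : ℝ → ClassicalSwing.State 4} (hc : (Kundur2A.csgPre.toModelRel (1 / 10) a).IsSolutionOn c (Ici 0))
    (h0V : deg2_A_ownV_nu4ibk3m1_pp_Vz (deg2_A_ownV_nu4ibk3m1_pp_Z (c 0)) ≤ γ)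
    (h0win : ∀ i : Fin 3, |RecastData.u Kundur2A.csgPre.angleOf (c 0) i.succ| < π) :
    (∀ t, 0 ≤ t → deg2_A_ownV_nu4ibk3m1_pp_Vz (deg2_A_ownV_nu4ibk3m1_pp_Z (c t)) ≤ γ) ∧
    (∀ i : Fin 3, ∀ t, 0 ≤ t → |RecastData.u Kundur2A.csgPre.angleOf (c t) i.succ| < π) ∧
    (∀ i : Fin 3, Tendsto (fun t ↦ RecastData.u Kundur2A.csgPre.angleOf (c t) i.succ) atTop (𝓝 0)) ∧
    (∀ i : Fin 3, Tendsto (fun t ↦ (c t).2 i.succ - (c t).2 0) atTop (𝓝 0)) := by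
  -- continuity of the solution and of the relative angle deviations on `[0, ∞)`
  have hcc : ContinuousOn c (Ici 0) := fun t ht ↦ (hc t ht).continuousWithinAt
  have h1c : ∀ j, ContinuousOn (fun τ ↦ (c τ).1 j) (Ici 0) := fun j ↦
    ((continuous_apply j).comp continuous_fst).comp_continuousOn hcc
  have hu : ∀ i : Fin 3, ContinuousOn (fun t ↦ RecastData.u Kundur2A.csgPre.angleOf (c t) i.succ) (Ici 0) := by
    intro i
    simp only [RecastData.u]
    exact ((h1c _).sub (h1c 0)).sub continuousOn_const
  set z : ℝ → Fin 9 → ℝ := fun τ ↦ deg2_A_ownV_nu4ibk3m1_pp_Z (c τ) with hzdef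
  have hzc : ContinuousOn z (Ici 0) := by
    refine continuousOn_pi.2 fun k t ht ↦ ?_
    exact (Kundur2A.hasDerivWithinAt_embedRel (1 / 10) a hc ht k).continuousWithinAt
  have hz : ∀ t, 0 ≤ t → HasDerivWithinAt z (deg2_A_ownV_nu4ibk3m1_pp_F (z t)) (Ici t) t := fun t ht ↦
    (deg2_A_ownV_nu4ibk3m1_pp_hasDerivWithinAt_Z a hc ht).mono (Ici_subset_Ici.2 ht)
  obtain ⟨hinv, hlim⟩ := deg2_A_ownV_nu4ibk3m1_pp_roa hγ0 hγ hzc hz (deg2_A_ownV_nu4ibk3m1_pp_Z_mem_M (c 0)) h0V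
  have hall := tendsto_pi_nhds.1 hlim
  -- no pole slip: `κ_i ≤ 1 < 2` gives `cos u_i ≥ 0 > -1`
  have hcos : ∀ i : Fin 3, ∀ t, 0 ≤ t → -1 < cos (RecastData.u Kundur2A.csgPre.angleOf (c t) i.succ) := by
    intro i t ht
    obtain ⟨-, hk1, hk2, hk3⟩ := hinv t ht
    fin_cases i
    · simp only [hzdef, deg2_A_ownV_nu4ibk3m1_pp_Z_eq_1] at hk1
      show -1 < cos (RecastData.u Kundur2A.csgPre.angleOf (c t) 1)
      linarith
    · simp only [hzdef, deg2_A_ownV_nu4ibk3m1_pp_Z_eq_3] at hk2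
      show -1 < cos (RecastData.u Kundur2A.csgPre.angleOf (c t) 2)
      linarith
    · simp only [hzdef, deg2_A_ownV_nu4ibk3m1_pp_Z_eq_5] at hk3
      show -1 < cos (RecastData.u Kundur2A.csgPre.angleOf (c t) 3)
      linarith
  have hwin : ∀ i : Fin 3, ∀ t, 0 ≤ t → |RecastData.u Kundur2A.csgPre.angleOf (c t) i.succ| < π := fun i ↦
    abs_lt_pi_of_neg_one_lt_cos (hu i) (h0win i) (hcos i)
  refine ⟨fun t ht ↦ (hinv t ht).1, hwin, fun i ↦ ?_, fun i ↦ ?_⟩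
  · fin_cases i
    · have h := hall 1
      simp only [hzdef, deg2_A_ownV_nu4ibk3m1_pp_Z_eq_1] at h
      exact tendsto_zero_of_one_sub_cos_tendsto (hwin 0) h
    · have h := hall 3
      simp only [hzdef, deg2_A_ownV_nu4ibk3m1_pp_Z_eq_3] at h
      exact tendsto_zero_of_one_sub_cos_tendsto (hwin 1) h
    · have h := hall 5
      simp only [hzdef, deg2_A_ownV_nu4ibk3m1_pp_Z_eq_5] at h
      exact tendsto_zero_of_one_sub_cos_tendsto (hwin 2) h
  · fin_cases i
    · have h := hall 6
      simp only [hzdef, deg2_A_ownV_nu4ibk3m1_pp_Z_eq_6, Pi.zero_apply] at h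
      simpa using h
    · have h := hall 7
      simp only [hzdef, deg2_A_ownV_nu4ibk3m1_pp_Z_eq_7, Pi.zero_apply] at h
      simpa using h
    · have h := hall 8
      simp only [hzdef, deg2_A_ownV_nu4ibk3m1_pp_Z_eq_8, Pi.zero_apply] at h
      simpa using h

end

end Summit.Ventures.GridStability.Bench.KUNDUR2ACSG
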